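import Summits.CriticalPhenomena.PercolationContinuityZ3.Theorems.PercNearOneGluingNoHeavyLowerTailHexagonRowsKernel
import HarnessLib

/-!
# `NoHeavyLowerTail` (stmt-CriticalPhenomena-4575) — the six HEXAGON law-level rows `S0, S0ᵍ, S1′, S1, S2′, S2` are theorems

Support file (certificate seat `prim-cert-1`, gen 7; `--supports stmt-CriticalPhenomena-4575`, crux closed `proved`).
No definitions, no named facts, no sorries.  Kernel lemmas: `…HexagonRowsKernel.lean`.

prim-cplus-coupling (A5-COUPLING-gen15 §4–5) showed that the LP polygon of the CLUB-Ψ certificate is the hexagon of six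
principal half-planes and extracted its law-level content: sharp 4-point ("observer SET `N`, ports `x, y`, witness `z`")
inequalities `S0, S1, S1′, S2, S2′` (ttrl cp-gz PRINC-RED (C): 0 negative / 657k–818k exact instances, `n ≤ 6` exhaustive +
adversarial palettes; 20–33 % equalities).  `S1` and `S2′` were proved (marker dominance at a principal up-set), `S0, S1′, S2`
stayed "conjectures of record, not needed by any proof" (INEQ-CLAIMS 2026-08-20 l.1027/1178) and were handed to this seat for a
certificate search.  RESULTS (this seat, gen 7):
(1) NO product-multiplier certificate of degree 3 exists for any of the five over the full two-set/Harris/Gladkov/BK/BHK/AG⁺/GRP3PTLB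
    row cone on the 15-cell four-point law (kit j097108: column generation, pricing clean; the same engine re-certifies cp-gz's
    `4PT` and `I3`), consistent with their conditional (covariance-transfer) nature;
(2) but each row IS the CLUB-Ψ inequality `K_x(F) ≥ 0` (`ClubPsi.clubPsi_allWeights`, prim-cplus-coupling gen 16) or the glued
    GΨ₃ inequality `G(F) ≥ 0` (`Q7Psi.gpsi_three_glued`, gen 14) at an explicit BALANCED test function with `Dx(F) = Dy(F) = 0`:
      `F0 = e₂e₃·1{y∨z} + e₁e₃·1{x∨z} + e₁e₂·1{x∨y}`   (`eᵢ = μ(Eᵢ)`):   `K_x(F0) = S0`,  `G(F0) = S0ᵍ`;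
      `F1 = e₁e₂·1{x∧y} + a₁e₂·1{y∨z} + a₁e₁·1{x∨z}`   (`a₁ = μ(A1)`):   `K_x(F1) = S1′`, `G(F1) = S1`;
      `F2 = b₃e₂·1{x∨y} + e₃e₂·1{y∧z} + e₃b₃·1{x∨z}`   (`b₃ = μ(B3)`):   `K_x(F2) = S2′`, `G(F2) = S2`,
    exactly (no slack) on the 15-cell law — found by an LP over the 18 relay-generated up-sets (kit j097217) and checked
    symbolically (work/s4/hexfun.py).  So "hexagon ≠ ∅" has no content beyond CLUB-Ψ and glued GΨ₃ at `F0, F1, F2`.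
Notation (`μ = prodBernoulli w`): `Ov = {N↔v} = {∃ n ∈ N, v↔n}`, `Ēv = {N↮v}`, `W2 = Oy ∩ Ēx ∩ Ēz`, `E1 = {x↮y}∩{x↮z}`,
`E2 = {y↮x}∩{y↮z}`, `E3 = {z↮x}∩{z↮y}`, `A1 = {x↔y}∩{x↮z}`, `B3 = {z↔y}∩{z↮x}`, `J' = (Ox ∪ Oy) ∩ Ēz`.
The theorems (cleared denominators; the conditional forms of gen15 §5 in the docstrings), `x, y, z` distinct, every `N`, every `w`:
* `hexagon_S0`  : `μ(Ēy∩Ēz∩E1)·e₂e₃ + μ(W2)·e₁e₃ ≤ μ(Ēz∩E3)·e₁e₂`;      `hexagon_S0_glued` : `μ(W1)·e₂e₃ + μ(W2)·e₁e₃ ≤ μ(J'∩E3)·e₁e₂`;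
* `hexagon_S1'` : `μ(Ēy∩Ēz∩E1)·a₁e₂ + μ(W2)·a₁e₁ ≤ (μ(Ox∩Oy∩Ēz) + μ(E∩A1))·e₁e₂`;  `hexagon_S1` : `μ(W1)·a₁e₂ + μ(W2)·a₁e₁ ≤ μ(Ox∩Oy∩Ēz)·e₁e₂`;
* `hexagon_S2'` : `μ(Ēz∩B3)·e₃e₂ + μ(W2)·e₃b₃ ≤ μ(Ēz∩E3)·b₃e₂`;        `hexagon_S2` : `μ(Ox∩Ēz∩B3)·e₃e₂ + μ(W2)·e₃b₃ ≤ μ(J'∩E3)·b₃e₂`.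
For a single observer `N = {o}` (`Ox ∩ Oy ∩ Ēz = {o↔x, o↔y, o↮z} ⊆ A1`) these are literally the rows of gen15 §5 / PRINC-RED (C);
for `|N| ≥ 2` the `F1` rows are the (slightly weaker) glued forms (`x, y ∈ C_N` in place of `x ↔ y`).
-/

namespace Summit.CriticalPhenomena.PercolationContinuityZ3.Theorems

open MeasureTheory Set Literature.Probability.LatticeModels Literature.Probability.Percolation
open scoped Classical
open KNPreFKG BHK2006 DecisionTree LonePortSum LonePortSumGeneral

noncomputable section

namespace HexagonRows

universe u

variable {V : Type u} [Fintype V]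

/-! ## Monotone indicator test functions -/

omit [Fintype V] in
/-- `1{a ∈ · ∨ b ∈ ·}` is monotone. [folklore] -/
theorem ite_or_mono (a b : V) {S T : Set V} (h : S ⊆ T) :
    (if a ∈ S ∨ b ∈ S then (1 : ℝ) else 0) ≤ (if a ∈ T ∨ b ∈ T then 1 else 0) := by
  by_cases hS : a ∈ S ∨ b ∈ S
  · rw [if_pos hS, if_pos (hS.imp (fun h' => h h') (fun h' => h h'))]
  · rw [if_neg hS]; split_ifs <;> norm_num

omit [Fintype V] in
/-- `1{a ∈ · ∧ b ∈ ·}` is monotone. [folklore] -/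
theorem ite_and_mono (a b : V) {S T : Set V} (h : S ⊆ T) :
    (if a ∈ S ∧ b ∈ S then (1 : ℝ) else 0) ≤ (if a ∈ T ∧ b ∈ T then 1 else 0) := by
  by_cases hS : a ∈ S ∧ b ∈ S
  · rw [if_pos hS, if_pos ⟨h hS.1, h hS.2⟩]
  · rw [if_neg hS]; split_ifs <;> norm_num

omit [Fintype V] in
/-- An indicator is nonnegative. [folklore] -/
theorem ite_nonneg' (p : Prop) [Decidable p] : (0 : ℝ) ≤ (if p then 1 else 0) := by
  split_ifs <;> norm_num

/-! ## `F0`: the rows `S0` (CLUB) and `S0ᵍ` (glued) -/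

/-- **Hexagon row `S0`** (prim-cplus-coupling A5-COUPLING-gen15 §5, "`Λ1 + φ2 ≤ Σ`"; conjecture of record, census-clean; now a
theorem).  For distinct `x, y, z`, every observer set `N` and every weight vector, in the conditional form
`P(N↮y, N↮z | x↮y, x↮z) + P(N↔y, N↮x, N↮z | y↮x, y↮z) ≤ P(N↮z | z↮x, z↮y)`; here with denominators cleared:
`μ(Ēy∩Ēz∩E1)·μ(E2)μ(E3) + μ(W2)·μ(E1)μ(E3) ≤ μ(Ēz∩E3)·μ(E1)μ(E2)`.
Proof: `= K_x(F0) ≥ 0` by CLUB-Ψ (`ClubPsi.clubPsi_allWeights`) at the balanced test function `F0` (`Dx = Dy = 0`).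
[cite: KozmaNitzan2024, §5.1 (pp. 31–32), Question 9 (p. 36)] -/
theorem hexagon_S0 (w : Sym2 V → unitInterval) (x y z : V) (N : Set V) (hxy : x ≠ y) (hxz : x ≠ z) (hyz : y ≠ z) :
    (prodBernoulli w).real (({ω : BondConfig V | ∀ n ∈ N, ¬ (openGraph ω).Reachable y n} ∩
          {ω | ∀ n ∈ N, ¬ (openGraph ω).Reachable z n}) ∩
          ({ω | ¬ (openGraph ω).Reachable x y} ∩ {ω | ¬ (openGraph ω).Reachable x z})) *
        (prodBernoulli w).real ({ω : BondConfig V | ¬ (openGraph ω).Reachable y x} ∩ {ω | ¬ (openGraph ω).Reachable y z}) *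
        (prodBernoulli w).real ({ω : BondConfig V | ¬ (openGraph ω).Reachable z x} ∩ {ω | ¬ (openGraph ω).Reachable z y}) +
      (prodBernoulli w).real ({ω : BondConfig V | ∃ n ∈ N, (openGraph ω).Reachable y n} ∩
          ({ω | ∀ n ∈ N, ¬ (openGraph ω).Reachable x n} ∩ {ω | ∀ n ∈ N, ¬ (openGraph ω).Reachable z n})) *
        (prodBernoulli w).real ({ω : BondConfig V | ¬ (openGraph ω).Reachable x y} ∩ {ω | ¬ (openGraph ω).Reachable x z}) *
        (prodBernoulli w).real ({ω : BondConfig V | ¬ (openGraph ω).Reachable z x} ∩ {ω | ¬ (openGraph ω).Reachable z y}) ≤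
    (prodBernoulli w).real ({ω : BondConfig V | ∀ n ∈ N, ¬ (openGraph ω).Reachable z n} ∩
          ({ω | ¬ (openGraph ω).Reachable z x} ∩ {ω | ¬ (openGraph ω).Reachable z y})) *
        (prodBernoulli w).real ({ω : BondConfig V | ¬ (openGraph ω).Reachable x y} ∩ {ω | ¬ (openGraph ω).Reachable x z}) *
        (prodBernoulli w).real ({ω : BondConfig V | ¬ (openGraph ω).Reachable y x} ∩ {ω | ¬ (openGraph ω).Reachable y z}) := by
  set μ := prodBernoulli w with hμ
  set Ox : Set (BondConfig V) := {ω | ∃ n ∈ N, (openGraph ω).Reachable x n} with hOx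
  set Oy : Set (BondConfig V) := {ω | ∃ n ∈ N, (openGraph ω).Reachable y n} with hOy
  set Ex : Set (BondConfig V) := {ω | ∀ n ∈ N, ¬ (openGraph ω).Reachable x n} with hEx
  set Ey : Set (BondConfig V) := {ω | ∀ n ∈ N, ¬ (openGraph ω).Reachable y n} with hEy
  set Ez : Set (BondConfig V) := {ω | ∀ n ∈ N, ¬ (openGraph ω).Reachable z n} with hEz
  set E1 : Set (BondConfig V) := {ω | ¬ (openGraph ω).Reachable x y} ∩ {ω | ¬ (openGraph ω).Reachable x z} with hE1
  set E2 : Set (BondConfig V) := {ω | ¬ (openGraph ω).Reachable y x} ∩ {ω | ¬ (openGraph ω).Reachable y z} with hE2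
  set E3 : Set (BondConfig V) := {ω | ¬ (openGraph ω).Reachable z x} ∩ {ω | ¬ (openGraph ω).Reachable z y} with hE3
  set α : ℝ := μ.real E2 * μ.real E3 with hα
  set β : ℝ := μ.real E1 * μ.real E3 with hβ
  set γ : ℝ := μ.real E1 * μ.real E2 with hγ
  have hα0 : 0 ≤ α := mul_nonneg measureReal_nonneg measureReal_nonneg
  have hβ0 : 0 ≤ β := mul_nonneg measureReal_nonneg measureReal_nonneg
  have hγ0 : 0 ≤ γ := mul_nonneg measureReal_nonneg measureReal_nonneg
  set F : Set V → ℝ := fun S =>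
    α * (if y ∈ S ∨ z ∈ S then 1 else 0) + β * (if x ∈ S ∨ z ∈ S then 1 else 0) + γ * (if x ∈ S ∨ y ∈ S then 1 else 0) with hF
  have hFm : ∀ S T : Set V, S ⊆ T → F S ≤ F T := fun S T h =>
    add_le_add (add_le_add (mul_le_mul_of_nonneg_left (ite_or_mono y z h) hα0)
      (mul_le_mul_of_nonneg_left (ite_or_mono x z h) hβ0)) (mul_le_mul_of_nonneg_left (ite_or_mono x y h) hγ0)
  have hF0 : ∀ S, 0 ≤ F S := fun S =>
    add_nonneg (add_nonneg (mul_nonneg hα0 (ite_nonneg' _)) (mul_nonneg hβ0 (ite_nonneg' _))) (mul_nonneg hγ0 (ite_nonneg' _))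
  obtain ⟨hDx, hDy, hK, -⟩ := eval_F0 w x y z N α β γ F hF Ox Oy Ex Ey Ez E1 E2 E3 hOx hOy hEx hEy hEz hE1 hE2 hE3
  have hbal1 : γ * μ.real E3 - α * μ.real E1 = 0 := by rw [hα, hγ]; ring
  have hbal2 : γ * μ.real E3 - β * μ.real E2 = 0 := by rw [hβ, hγ]; ring
  have hDx0 : ∫ ω, F (openCluster ω z) ∂μ ≤ ∫ ω, F (openCluster ω x) ∂μ := by linarith
  have hDy0 : ∫ ω, F (openCluster ω z) ∂μ ≤ ∫ ω, F (openCluster ω y) ∂μ := by linarith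
  have key := ClubPsi.clubPsi_allWeights w x y z N hxy.symm hyz hxz F hFm hF0 hDx0 hDy0
  rw [hα, hβ, hγ] at hK
  linarith

/-! ## The glued `S0`, and the rows from `F1` and `F2` -/

/-- **Hexagon row `S0ᵍ`** (glued version of `S0`, A5-COUPLING-gen15 §5 "`φ1 + φ2 ≤ Σg`"):
`P(N↔x, N↮y, N↮z | x↮y, x↮z) + P(N↔y, N↮x, N↮z | y↮x, y↮z) ≤ P((N↔x ∨ N↔y), N↮z | z↮x, z↮y)`, denominators cleared:
`μ(W1)·μ(E2)μ(E3) + μ(W2)·μ(E1)μ(E3) ≤ μ(J'∩E3)·μ(E1)μ(E2)`.  Proof: `= G(F0) ≥ 0` by the glued (GΨ₃)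
(`Q7Psi.gpsi_three_glued`) at `F0`. [cite: KozmaNitzan2024, §5.1 (pp. 31–32), Question 9 (p. 36)] -/
theorem hexagon_S0_glued (w : Sym2 V → unitInterval) (x y z : V) (N : Set V) (hxy : x ≠ y) (hxz : x ≠ z) (hyz : y ≠ z) :
    (prodBernoulli w).real ({ω : BondConfig V | ∃ n ∈ N, (openGraph ω).Reachable x n} ∩
          ({ω : BondConfig V | ∀ n ∈ N, ¬ (openGraph ω).Reachable y n} ∩ {ω : BondConfig V | ∀ n ∈ N, ¬ (openGraph ω).Reachable z n})) *
        (prodBernoulli w).real ({ω : BondConfig V | ¬ (openGraph ω).Reachable y x} ∩ {ω | ¬ (openGraph ω).Reachable y z}) *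
        (prodBernoulli w).real ({ω : BondConfig V | ¬ (openGraph ω).Reachable z x} ∩ {ω | ¬ (openGraph ω).Reachable z y}) +
      (prodBernoulli w).real ({ω : BondConfig V | ∃ n ∈ N, (openGraph ω).Reachable y n} ∩
          ({ω : BondConfig V | ∀ n ∈ N, ¬ (openGraph ω).Reachable x n} ∩ {ω : BondConfig V | ∀ n ∈ N, ¬ (openGraph ω).Reachable z n})) *
        (prodBernoulli w).real ({ω : BondConfig V | ¬ (openGraph ω).Reachable x y} ∩ {ω | ¬ (openGraph ω).Reachable x z}) *
        (prodBernoulli w).real ({ω : BondConfig V | ¬ (openGraph ω).Reachable z x} ∩ {ω | ¬ (openGraph ω).Reachable z y}) ≤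
    (prodBernoulli w).real ((({ω : BondConfig V | ∃ n ∈ N, (openGraph ω).Reachable x n} ∪ {ω : BondConfig V | ∃ n ∈ N, (openGraph ω).Reachable y n}) ∩
          {ω : BondConfig V | ∀ n ∈ N, ¬ (openGraph ω).Reachable z n}) ∩
          ({ω : BondConfig V | ¬ (openGraph ω).Reachable z x} ∩ {ω | ¬ (openGraph ω).Reachable z y})) *
        (prodBernoulli w).real ({ω : BondConfig V | ¬ (openGraph ω).Reachable x y} ∩ {ω | ¬ (openGraph ω).Reachable x z}) *
        (prodBernoulli w).real ({ω : BondConfig V | ¬ (openGraph ω).Reachable y x} ∩ {ω | ¬ (openGraph ω).Reachable y z}) := by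
  set μ := prodBernoulli w with hμ
  set Ox : Set (BondConfig V) := {ω | ∃ n ∈ N, (openGraph ω).Reachable x n} with hOx
  set Oy : Set (BondConfig V) := {ω | ∃ n ∈ N, (openGraph ω).Reachable y n} with hOy
  set Ex : Set (BondConfig V) := {ω | ∀ n ∈ N, ¬ (openGraph ω).Reachable x n} with hEx
  set Ey : Set (BondConfig V) := {ω | ∀ n ∈ N, ¬ (openGraph ω).Reachable y n} with hEy
  set Ez : Set (BondConfig V) := {ω | ∀ n ∈ N, ¬ (openGraph ω).Reachable z n} with hEz
  set E1 : Set (BondConfig V) := {ω | ¬ (openGraph ω).Reachable x y} ∩ {ω | ¬ (openGraph ω).Reachable x z} with hE1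
  set E2 : Set (BondConfig V) := {ω | ¬ (openGraph ω).Reachable y x} ∩ {ω | ¬ (openGraph ω).Reachable y z} with hE2
  set E3 : Set (BondConfig V) := {ω | ¬ (openGraph ω).Reachable z x} ∩ {ω | ¬ (openGraph ω).Reachable z y} with hE3
  set A1 : Set (BondConfig V) := openConn x y ∩ {ω | ¬ (openGraph ω).Reachable x z} with hA1
  set B3 : Set (BondConfig V) := openConn z y ∩ {ω | ¬ (openGraph ω).Reachable z x} with hB3
  set α : ℝ := μ.real E2 * μ.real E3 with hα
  set β : ℝ := μ.real E1 * μ.real E3 with hβ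
  set γ : ℝ := μ.real E1 * μ.real E2 with hγ
  have hα0 : 0 ≤ α := mul_nonneg measureReal_nonneg measureReal_nonneg
  have hβ0 : 0 ≤ β := mul_nonneg measureReal_nonneg measureReal_nonneg
  have hγ0 : 0 ≤ γ := mul_nonneg measureReal_nonneg measureReal_nonneg
  set F : Set V → ℝ := fun S =>
    α * (if y ∈ S ∨ z ∈ S then 1 else 0) + β * (if x ∈ S ∨ z ∈ S then 1 else 0) + γ * (if x ∈ S ∨ y ∈ S then 1 else 0) with hF
  have hFm : ∀ S T : Set V, S ⊆ T → F S ≤ F T := fun S T h =>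
    add_le_add (add_le_add (mul_le_mul_of_nonneg_left (ite_or_mono y z h) hα0)
      (mul_le_mul_of_nonneg_left (ite_or_mono x z h) hβ0)) (mul_le_mul_of_nonneg_left (ite_or_mono x y h) hγ0)
  have hF0 : ∀ S, 0 ≤ F S := fun S =>
    add_nonneg (add_nonneg (mul_nonneg hα0 (ite_nonneg' _)) (mul_nonneg hβ0 (ite_nonneg' _))) (mul_nonneg hγ0 (ite_nonneg' _))
  obtain ⟨hDx, hDy, hK, hG⟩ := eval_F0 w x y z N α β γ F hF Ox Oy Ex Ey Ez E1 E2 E3 hOx hOy hEx hEy hEz hE1 hE2 hE3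
  have hbal1 : γ * μ.real E3 - α * μ.real E1 = 0 := by rw [hα, hγ]; ring
  have hbal2 : γ * μ.real E3 - β * μ.real E2 = 0 := by rw [hβ, hγ]; ring
  have hDx0 : ∫ ω, F (openCluster ω z) ∂μ ≤ ∫ ω, F (openCluster ω x) ∂μ := by linarith
  have hDy0 : ∫ ω, F (openCluster ω z) ∂μ ≤ ∫ ω, F (openCluster ω y) ∂μ := by linarith
  have key := Q7Psi.gpsi_three_glued w x y z N hxy hxz hyz F hFm hDx0 hDy0
  rw [hα, hβ, hγ] at hG
  linarith

/-- **Hexagon row `S1′`** (A5-COUPLING-gen15 §5 "CLUB I1′", conjecture of record, census-clean; now a theorem).  Single observer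
`N = {o}`: `P(o↮z | x↔y, x↮z) ≥ P(o↮y, o↮z | x↮y, x↮z) + P(o↔y, o↮x, o↮z | y↮x, y↮z)`; for an observer SET the glued form
(`{x, y ∈ C_N}` in place of `{x↔y}` on `{N↔x}`), denominators cleared:
`μ(Ēy∩Ēz∩E1)·μ(A1)μ(E2) + μ(W2)·μ(A1)μ(E1) ≤ (μ(Ox∩Oy∩Ēz) + μ(E∩A1))·μ(E1)μ(E2)`.
Proof: `= K_x(F1) ≥ 0` by CLUB-Ψ (`ClubPsi.clubPsi_allWeights`) at the balanced test function `F1`.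
[cite: KozmaNitzan2024, §5.1 (pp. 31–32), Question 9 (p. 36)] -/
theorem hexagon_S1' (w : Sym2 V → unitInterval) (x y z : V) (N : Set V) (hxy : x ≠ y) (hxz : x ≠ z) (hyz : y ≠ z) :
    (prodBernoulli w).real (({ω : BondConfig V | ∀ n ∈ N, ¬ (openGraph ω).Reachable y n} ∩
          {ω : BondConfig V | ∀ n ∈ N, ¬ (openGraph ω).Reachable z n}) ∩
          ({ω : BondConfig V | ¬ (openGraph ω).Reachable x y} ∩ {ω | ¬ (openGraph ω).Reachable x z})) *
        (prodBernoulli w).real (openConn x y ∩ {ω : BondConfig V | ¬ (openGraph ω).Reachable x z}) *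
        (prodBernoulli w).real ({ω : BondConfig V | ¬ (openGraph ω).Reachable y x} ∩ {ω | ¬ (openGraph ω).Reachable y z}) +
      (prodBernoulli w).real ({ω : BondConfig V | ∃ n ∈ N, (openGraph ω).Reachable y n} ∩
          ({ω : BondConfig V | ∀ n ∈ N, ¬ (openGraph ω).Reachable x n} ∩ {ω : BondConfig V | ∀ n ∈ N, ¬ (openGraph ω).Reachable z n})) *
        (prodBernoulli w).real (openConn x y ∩ {ω : BondConfig V | ¬ (openGraph ω).Reachable x z}) *
        (prodBernoulli w).real ({ω : BondConfig V | ¬ (openGraph ω).Reachable x y} ∩ {ω | ¬ (openGraph ω).Reachable x z}) ≤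
    ((prodBernoulli w).real ({ω : BondConfig V | ∃ n ∈ N, (openGraph ω).Reachable x n} ∩
          ({ω : BondConfig V | ∃ n ∈ N, (openGraph ω).Reachable y n} ∩ {ω : BondConfig V | ∀ n ∈ N, ¬ (openGraph ω).Reachable z n})) +
        (prodBernoulli w).real (({ω : BondConfig V | ∀ n ∈ N, ¬ (openGraph ω).Reachable x n} ∩
          ({ω : BondConfig V | ∀ n ∈ N, ¬ (openGraph ω).Reachable y n} ∩ {ω : BondConfig V | ∀ n ∈ N, ¬ (openGraph ω).Reachable z n})) ∩
          (openConn x y ∩ {ω : BondConfig V | ¬ (openGraph ω).Reachable x z}))) *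
        (prodBernoulli w).real ({ω : BondConfig V | ¬ (openGraph ω).Reachable x y} ∩ {ω | ¬ (openGraph ω).Reachable x z}) *
        (prodBernoulli w).real ({ω : BondConfig V | ¬ (openGraph ω).Reachable y x} ∩ {ω | ¬ (openGraph ω).Reachable y z}) := by
  set μ := prodBernoulli w with hμ
  set Ox : Set (BondConfig V) := {ω | ∃ n ∈ N, (openGraph ω).Reachable x n} with hOx
  set Oy : Set (BondConfig V) := {ω | ∃ n ∈ N, (openGraph ω).Reachable y n} with hOy
  set Ex : Set (BondConfig V) := {ω | ∀ n ∈ N, ¬ (openGraph ω).Reachable x n} with hEx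
  set Ey : Set (BondConfig V) := {ω | ∀ n ∈ N, ¬ (openGraph ω).Reachable y n} with hEy
  set Ez : Set (BondConfig V) := {ω | ∀ n ∈ N, ¬ (openGraph ω).Reachable z n} with hEz
  set E1 : Set (BondConfig V) := {ω | ¬ (openGraph ω).Reachable x y} ∩ {ω | ¬ (openGraph ω).Reachable x z} with hE1
  set E2 : Set (BondConfig V) := {ω | ¬ (openGraph ω).Reachable y x} ∩ {ω | ¬ (openGraph ω).Reachable y z} with hE2
  set E3 : Set (BondConfig V) := {ω | ¬ (openGraph ω).Reachable z x} ∩ {ω | ¬ (openGraph ω).Reachable z y} with hE3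
  set A1 : Set (BondConfig V) := openConn x y ∩ {ω | ¬ (openGraph ω).Reachable x z} with hA1
  set B3 : Set (BondConfig V) := openConn z y ∩ {ω | ¬ (openGraph ω).Reachable z x} with hB3
  set α : ℝ := μ.real A1 * μ.real E2 with hα
  set β : ℝ := μ.real A1 * μ.real E1 with hβ
  set γ : ℝ := μ.real E1 * μ.real E2 with hγ
  have hα0 : 0 ≤ α := mul_nonneg measureReal_nonneg measureReal_nonneg
  have hβ0 : 0 ≤ β := mul_nonneg measureReal_nonneg measureReal_nonneg
  have hγ0 : 0 ≤ γ := mul_nonneg measureReal_nonneg measureReal_nonneg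
  set F : Set V → ℝ := fun S =>
    γ * (if x ∈ S ∧ y ∈ S then 1 else 0) + α * (if y ∈ S ∨ z ∈ S then 1 else 0) + β * (if x ∈ S ∨ z ∈ S then 1 else 0) with hF
  have hFm : ∀ S T : Set V, S ⊆ T → F S ≤ F T := fun S T h =>
    add_le_add (add_le_add (mul_le_mul_of_nonneg_left (ite_and_mono x y h) hγ0)
      (mul_le_mul_of_nonneg_left (ite_or_mono y z h) hα0)) (mul_le_mul_of_nonneg_left (ite_or_mono x z h) hβ0)
  have hF0 : ∀ S, 0 ≤ F S := fun S =>
    add_nonneg (add_nonneg (mul_nonneg hγ0 (ite_nonneg' _)) (mul_nonneg hα0 (ite_nonneg' _))) (mul_nonneg hβ0 (ite_nonneg' _))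
  obtain ⟨hDx, hDy, hK, hG⟩ := eval_F1 w x y z N α β γ F hF Ox Oy Ex Ey Ez E1 E2 A1 hOx hOy hEx hEy hEz hE1 hE2 hA1
  have hbal1 : γ * μ.real A1 - α * μ.real E1 = 0 := by rw [hα, hγ]; ring
  have hbal2 : γ * μ.real A1 - β * μ.real E2 = 0 := by rw [hβ, hγ]; ring
  have hDx0 : ∫ ω, F (openCluster ω z) ∂μ ≤ ∫ ω, F (openCluster ω x) ∂μ := by linarith
  have hDy0 : ∫ ω, F (openCluster ω z) ∂μ ≤ ∫ ω, F (openCluster ω y) ∂μ := by linarith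
  have key := ClubPsi.clubPsi_allWeights w x y z N hxy.symm hyz hxz F hFm hF0 hDx0 hDy0
  rw [hα, hβ, hγ] at hK
  linarith

/-- **Hexagon row `S1`** (A5-COUPLING-gen15 §5 "glued I1′"; the coupling seat proved it as marker dominance at a principal up-set,
`Q7Psi.setMDL_principal`; here a one-line corollary).  Single observer: `P(o↔x, o↮z | x↔y, x↮z) ≥ φ1 + φ2`; observer SET
(glued form), denominators cleared: `μ(W1)·μ(A1)μ(E2) + μ(W2)·μ(A1)μ(E1) ≤ μ(Ox∩Oy∩Ēz)·μ(E1)μ(E2)`.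
Proof: `= G(F1) ≥ 0` by the glued (GΨ₃) (`Q7Psi.gpsi_three_glued`) at `F1`. [cite: KozmaNitzan2024, §5.1 (pp. 31–32), Question 9 (p. 36)] -/
theorem hexagon_S1 (w : Sym2 V → unitInterval) (x y z : V) (N : Set V) (hxy : x ≠ y) (hxz : x ≠ z) (hyz : y ≠ z) :
    (prodBernoulli w).real ({ω : BondConfig V | ∃ n ∈ N, (openGraph ω).Reachable x n} ∩
          ({ω : BondConfig V | ∀ n ∈ N, ¬ (openGraph ω).Reachable y n} ∩ {ω : BondConfig V | ∀ n ∈ N, ¬ (openGraph ω).Reachable z n})) *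
        (prodBernoulli w).real (openConn x y ∩ {ω : BondConfig V | ¬ (openGraph ω).Reachable x z}) *
        (prodBernoulli w).real ({ω : BondConfig V | ¬ (openGraph ω).Reachable y x} ∩ {ω | ¬ (openGraph ω).Reachable y z}) +
      (prodBernoulli w).real ({ω : BondConfig V | ∃ n ∈ N, (openGraph ω).Reachable y n} ∩
          ({ω : BondConfig V | ∀ n ∈ N, ¬ (openGraph ω).Reachable x n} ∩ {ω : BondConfig V | ∀ n ∈ N, ¬ (openGraph ω).Reachable z n})) *
        (prodBernoulli w).real (openConn x y ∩ {ω : BondConfig V | ¬ (openGraph ω).Reachable x z}) *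
        (prodBernoulli w).real ({ω : BondConfig V | ¬ (openGraph ω).Reachable x y} ∩ {ω | ¬ (openGraph ω).Reachable x z}) ≤
    (prodBernoulli w).real ({ω : BondConfig V | ∃ n ∈ N, (openGraph ω).Reachable x n} ∩
          ({ω : BondConfig V | ∃ n ∈ N, (openGraph ω).Reachable y n} ∩ {ω : BondConfig V | ∀ n ∈ N, ¬ (openGraph ω).Reachable z n})) *
        (prodBernoulli w).real ({ω : BondConfig V | ¬ (openGraph ω).Reachable x y} ∩ {ω | ¬ (openGraph ω).Reachable x z}) *
        (prodBernoulli w).real ({ω : BondConfig V | ¬ (openGraph ω).Reachable y x} ∩ {ω | ¬ (openGraph ω).Reachable y z}) := by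
  set μ := prodBernoulli w with hμ
  set Ox : Set (BondConfig V) := {ω | ∃ n ∈ N, (openGraph ω).Reachable x n} with hOx
  set Oy : Set (BondConfig V) := {ω | ∃ n ∈ N, (openGraph ω).Reachable y n} with hOy
  set Ex : Set (BondConfig V) := {ω | ∀ n ∈ N, ¬ (openGraph ω).Reachable x n} with hEx
  set Ey : Set (BondConfig V) := {ω | ∀ n ∈ N, ¬ (openGraph ω).Reachable y n} with hEy
  set Ez : Set (BondConfig V) := {ω | ∀ n ∈ N, ¬ (openGraph ω).Reachable z n} with hEz
  set E1 : Set (BondConfig V) := {ω | ¬ (openGraph ω).Reachable x y} ∩ {ω | ¬ (openGraph ω).Reachable x z} with hE1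
  set E2 : Set (BondConfig V) := {ω | ¬ (openGraph ω).Reachable y x} ∩ {ω | ¬ (openGraph ω).Reachable y z} with hE2
  set E3 : Set (BondConfig V) := {ω | ¬ (openGraph ω).Reachable z x} ∩ {ω | ¬ (openGraph ω).Reachable z y} with hE3
  set A1 : Set (BondConfig V) := openConn x y ∩ {ω | ¬ (openGraph ω).Reachable x z} with hA1
  set B3 : Set (BondConfig V) := openConn z y ∩ {ω | ¬ (openGraph ω).Reachable z x} with hB3
  set α : ℝ := μ.real A1 * μ.real E2 with hα
  set β : ℝ := μ.real A1 * μ.real E1 with hβ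
  set γ : ℝ := μ.real E1 * μ.real E2 with hγ
  have hα0 : 0 ≤ α := mul_nonneg measureReal_nonneg measureReal_nonneg
  have hβ0 : 0 ≤ β := mul_nonneg measureReal_nonneg measureReal_nonneg
  have hγ0 : 0 ≤ γ := mul_nonneg measureReal_nonneg measureReal_nonneg
  set F : Set V → ℝ := fun S =>
    γ * (if x ∈ S ∧ y ∈ S then 1 else 0) + α * (if y ∈ S ∨ z ∈ S then 1 else 0) + β * (if x ∈ S ∨ z ∈ S then 1 else 0) with hF
  have hFm : ∀ S T : Set V, S ⊆ T → F S ≤ F T := fun S T h =>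
    add_le_add (add_le_add (mul_le_mul_of_nonneg_left (ite_and_mono x y h) hγ0)
      (mul_le_mul_of_nonneg_left (ite_or_mono y z h) hα0)) (mul_le_mul_of_nonneg_left (ite_or_mono x z h) hβ0)
  have hF0 : ∀ S, 0 ≤ F S := fun S =>
    add_nonneg (add_nonneg (mul_nonneg hγ0 (ite_nonneg' _)) (mul_nonneg hα0 (ite_nonneg' _))) (mul_nonneg hβ0 (ite_nonneg' _))
  obtain ⟨hDx, hDy, hK, hG⟩ := eval_F1 w x y z N α β γ F hF Ox Oy Ex Ey Ez E1 E2 A1 hOx hOy hEx hEy hEz hE1 hE2 hA1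
  have hbal1 : γ * μ.real A1 - α * μ.real E1 = 0 := by rw [hα, hγ]; ring
  have hbal2 : γ * μ.real A1 - β * μ.real E2 = 0 := by rw [hβ, hγ]; ring
  have hDx0 : ∫ ω, F (openCluster ω z) ∂μ ≤ ∫ ω, F (openCluster ω x) ∂μ := by linarith
  have hDy0 : ∫ ω, F (openCluster ω z) ∂μ ≤ ∫ ω, F (openCluster ω y) ∂μ := by linarith
  have key := Q7Psi.gpsi_three_glued w x y z N hxy hxz hyz F hFm hDx0 hDy0
  rw [hα, hβ, hγ] at hG
  linarith

/-- **Hexagon row `S2′`** (A5-COUPLING-gen15 §5 "CLUB I2′"; proved by the coupling seat as `P1**-PLAIN-set` at the principal up-set,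
gen16 §2; here a one-line corollary):  `P(N↮z | z↮x, z↮y) ≥ P(N↮z | z↔y, z↮x) + P(N↔y, N↮x, N↮z | y↮x, y↮z)`
("separating `z` from `y` instead of gluing raises the chance that `N` misses `z` by at least `φ2`"), denominators cleared:
`μ(Ēz∩B3)·μ(E3)μ(E2) + μ(W2)·μ(E3)μ(B3) ≤ μ(Ēz∩E3)·μ(B3)μ(E2)`.
Proof: `= K_x(F2) ≥ 0` by CLUB-Ψ (`ClubPsi.clubPsi_allWeights`) at the balanced test function `F2`.
[cite: KozmaNitzan2024, §5.1 (pp. 31–32), Question 9 (p. 36)] -/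
theorem hexagon_S2' (w : Sym2 V → unitInterval) (x y z : V) (N : Set V) (hxy : x ≠ y) (hxz : x ≠ z) (hyz : y ≠ z) :
    (prodBernoulli w).real ({ω : BondConfig V | ∀ n ∈ N, ¬ (openGraph ω).Reachable z n} ∩
          (openConn z y ∩ {ω : BondConfig V | ¬ (openGraph ω).Reachable z x})) *
        (prodBernoulli w).real ({ω : BondConfig V | ¬ (openGraph ω).Reachable z x} ∩ {ω | ¬ (openGraph ω).Reachable z y}) *
        (prodBernoulli w).real ({ω : BondConfig V | ¬ (openGraph ω).Reachable y x} ∩ {ω | ¬ (openGraph ω).Reachable y z}) +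
      (prodBernoulli w).real ({ω : BondConfig V | ∃ n ∈ N, (openGraph ω).Reachable y n} ∩
          ({ω : BondConfig V | ∀ n ∈ N, ¬ (openGraph ω).Reachable x n} ∩ {ω : BondConfig V | ∀ n ∈ N, ¬ (openGraph ω).Reachable z n})) *
        (prodBernoulli w).real ({ω : BondConfig V | ¬ (openGraph ω).Reachable z x} ∩ {ω | ¬ (openGraph ω).Reachable z y}) *
        (prodBernoulli w).real (openConn z y ∩ {ω : BondConfig V | ¬ (openGraph ω).Reachable z x}) ≤
    (prodBernoulli w).real ({ω : BondConfig V | ∀ n ∈ N, ¬ (openGraph ω).Reachable z n} ∩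
          ({ω : BondConfig V | ¬ (openGraph ω).Reachable z x} ∩ {ω | ¬ (openGraph ω).Reachable z y})) *
        (prodBernoulli w).real (openConn z y ∩ {ω : BondConfig V | ¬ (openGraph ω).Reachable z x}) *
        (prodBernoulli w).real ({ω : BondConfig V | ¬ (openGraph ω).Reachable y x} ∩ {ω | ¬ (openGraph ω).Reachable y z}) := by
  set μ := prodBernoulli w with hμ
  set Ox : Set (BondConfig V) := {ω | ∃ n ∈ N, (openGraph ω).Reachable x n} with hOx
  set Oy : Set (BondConfig V) := {ω | ∃ n ∈ N, (openGraph ω).Reachable y n} with hOy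
  set Ex : Set (BondConfig V) := {ω | ∀ n ∈ N, ¬ (openGraph ω).Reachable x n} with hEx
  set Ey : Set (BondConfig V) := {ω | ∀ n ∈ N, ¬ (openGraph ω).Reachable y n} with hEy
  set Ez : Set (BondConfig V) := {ω | ∀ n ∈ N, ¬ (openGraph ω).Reachable z n} with hEz
  set E1 : Set (BondConfig V) := {ω | ¬ (openGraph ω).Reachable x y} ∩ {ω | ¬ (openGraph ω).Reachable x z} with hE1
  set E2 : Set (BondConfig V) := {ω | ¬ (openGraph ω).Reachable y x} ∩ {ω | ¬ (openGraph ω).Reachable y z} with hE2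
  set E3 : Set (BondConfig V) := {ω | ¬ (openGraph ω).Reachable z x} ∩ {ω | ¬ (openGraph ω).Reachable z y} with hE3
  set A1 : Set (BondConfig V) := openConn x y ∩ {ω | ¬ (openGraph ω).Reachable x z} with hA1
  set B3 : Set (BondConfig V) := openConn z y ∩ {ω | ¬ (openGraph ω).Reachable z x} with hB3
  set α : ℝ := μ.real E3 * μ.real E2 with hα
  set β : ℝ := μ.real E3 * μ.real B3 with hβ
  set γ : ℝ := μ.real B3 * μ.real E2 with hγ
  have hα0 : 0 ≤ α := mul_nonneg measureReal_nonneg measureReal_nonneg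
  have hβ0 : 0 ≤ β := mul_nonneg measureReal_nonneg measureReal_nonneg
  have hγ0 : 0 ≤ γ := mul_nonneg measureReal_nonneg measureReal_nonneg
  set F : Set V → ℝ := fun S =>
    γ * (if x ∈ S ∨ y ∈ S then 1 else 0) + α * (if y ∈ S ∧ z ∈ S then 1 else 0) + β * (if x ∈ S ∨ z ∈ S then 1 else 0) with hF
  have hFm : ∀ S T : Set V, S ⊆ T → F S ≤ F T := fun S T h =>
    add_le_add (add_le_add (mul_le_mul_of_nonneg_left (ite_or_mono x y h) hγ0)
      (mul_le_mul_of_nonneg_left (ite_and_mono y z h) hα0)) (mul_le_mul_of_nonneg_left (ite_or_mono x z h) hβ0)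
  have hF0 : ∀ S, 0 ≤ F S := fun S =>
    add_nonneg (add_nonneg (mul_nonneg hγ0 (ite_nonneg' _)) (mul_nonneg hα0 (ite_nonneg' _))) (mul_nonneg hβ0 (ite_nonneg' _))
  obtain ⟨hDx, hDy, hK, hG⟩ := eval_F2 w x y z N α β γ F hF Ox Oy Ex Ey Ez E2 E3 B3 hOx hOy hEx hEy hEz hE2 hE3 hB3
  have hbal1 : γ * μ.real E3 - α * μ.real B3 = 0 := by rw [hα, hγ]; ring
  have hbal2 : γ * μ.real E3 - β * μ.real E2 = 0 := by rw [hβ, hγ]; ring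
  have hDx0 : ∫ ω, F (openCluster ω z) ∂μ ≤ ∫ ω, F (openCluster ω x) ∂μ := by linarith
  have hDy0 : ∫ ω, F (openCluster ω z) ∂μ ≤ ∫ ω, F (openCluster ω y) ∂μ := by linarith
  have key := ClubPsi.clubPsi_allWeights w x y z N hxy.symm hyz hxz F hFm hF0 hDx0 hDy0
  rw [hα, hβ, hγ] at hK
  linarith

/-- **Hexagon row `S2`** (A5-COUPLING-gen15 §5 "glued I2′", conjecture of record, census-clean, the STRONGER of `S2/S2′`; now a
theorem):  `P((N↔x ∨ N↔y), N↮z | z↮x, z↮y) ≥ P(N↔x, N↮z | z↔y, z↮x) + P(N↔y, N↮x, N↮z | y↮x, y↮z)`, denominators cleared: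
`μ(Ox∩Ēz∩B3)·μ(E3)μ(E2) + μ(W2)·μ(E3)μ(B3) ≤ μ(J'∩E3)·μ(B3)μ(E2)`.
Proof: `= G(F2) ≥ 0` by the glued (GΨ₃) (`Q7Psi.gpsi_three_glued`) at the balanced test function `F2`.
[cite: KozmaNitzan2024, §5.1 (pp. 31–32), Question 9 (p. 36)] -/
theorem hexagon_S2 (w : Sym2 V → unitInterval) (x y z : V) (N : Set V) (hxy : x ≠ y) (hxz : x ≠ z) (hyz : y ≠ z) :
    (prodBernoulli w).real (({ω : BondConfig V | ∃ n ∈ N, (openGraph ω).Reachable x n} ∩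
          {ω : BondConfig V | ∀ n ∈ N, ¬ (openGraph ω).Reachable z n}) ∩
          (openConn z y ∩ {ω : BondConfig V | ¬ (openGraph ω).Reachable z x})) *
        (prodBernoulli w).real ({ω : BondConfig V | ¬ (openGraph ω).Reachable z x} ∩ {ω | ¬ (openGraph ω).Reachable z y}) *
        (prodBernoulli w).real ({ω : BondConfig V | ¬ (openGraph ω).Reachable y x} ∩ {ω | ¬ (openGraph ω).Reachable y z}) +
      (prodBernoulli w).real ({ω : BondConfig V | ∃ n ∈ N, (openGraph ω).Reachable y n} ∩
          ({ω : BondConfig V | ∀ n ∈ N, ¬ (openGraph ω).Reachable x n} ∩ {ω : BondConfig V | ∀ n ∈ N, ¬ (openGraph ω).Reachable z n})) *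
        (prodBernoulli w).real ({ω : BondConfig V | ¬ (openGraph ω).Reachable z x} ∩ {ω | ¬ (openGraph ω).Reachable z y}) *
        (prodBernoulli w).real (openConn z y ∩ {ω : BondConfig V | ¬ (openGraph ω).Reachable z x}) ≤
    (prodBernoulli w).real ((({ω : BondConfig V | ∃ n ∈ N, (openGraph ω).Reachable x n} ∪ {ω : BondConfig V | ∃ n ∈ N, (openGraph ω).Reachable y n}) ∩
          {ω : BondConfig V | ∀ n ∈ N, ¬ (openGraph ω).Reachable z n}) ∩
          ({ω : BondConfig V | ¬ (openGraph ω).Reachable z x} ∩ {ω | ¬ (openGraph ω).Reachable z y})) *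
        (prodBernoulli w).real (openConn z y ∩ {ω : BondConfig V | ¬ (openGraph ω).Reachable z x}) *
        (prodBernoulli w).real ({ω : BondConfig V | ¬ (openGraph ω).Reachable y x} ∩ {ω | ¬ (openGraph ω).Reachable y z}) := by
  set μ := prodBernoulli w with hμ
  set Ox : Set (BondConfig V) := {ω | ∃ n ∈ N, (openGraph ω).Reachable x n} with hOx
  set Oy : Set (BondConfig V) := {ω | ∃ n ∈ N, (openGraph ω).Reachable y n} with hOy
  set Ex : Set (BondConfig V) := {ω | ∀ n ∈ N, ¬ (openGraph ω).Reachable x n} with hEx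
  set Ey : Set (BondConfig V) := {ω | ∀ n ∈ N, ¬ (openGraph ω).Reachable y n} with hEy
  set Ez : Set (BondConfig V) := {ω | ∀ n ∈ N, ¬ (openGraph ω).Reachable z n} with hEz
  set E1 : Set (BondConfig V) := {ω | ¬ (openGraph ω).Reachable x y} ∩ {ω | ¬ (openGraph ω).Reachable x z} with hE1
  set E2 : Set (BondConfig V) := {ω | ¬ (openGraph ω).Reachable y x} ∩ {ω | ¬ (openGraph ω).Reachable y z} with hE2
  set E3 : Set (BondConfig V) := {ω | ¬ (openGraph ω).Reachable z x} ∩ {ω | ¬ (openGraph ω).Reachable z y} with hE3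
  set A1 : Set (BondConfig V) := openConn x y ∩ {ω | ¬ (openGraph ω).Reachable x z} with hA1
  set B3 : Set (BondConfig V) := openConn z y ∩ {ω | ¬ (openGraph ω).Reachable z x} with hB3
  set α : ℝ := μ.real E3 * μ.real E2 with hα
  set β : ℝ := μ.real E3 * μ.real B3 with hβ
  set γ : ℝ := μ.real B3 * μ.real E2 with hγ
  have hα0 : 0 ≤ α := mul_nonneg measureReal_nonneg measureReal_nonneg
  have hβ0 : 0 ≤ β := mul_nonneg measureReal_nonneg measureReal_nonneg
  have hγ0 : 0 ≤ γ := mul_nonneg measureReal_nonneg measureReal_nonneg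
  set F : Set V → ℝ := fun S =>
    γ * (if x ∈ S ∨ y ∈ S then 1 else 0) + α * (if y ∈ S ∧ z ∈ S then 1 else 0) + β * (if x ∈ S ∨ z ∈ S then 1 else 0) with hF
  have hFm : ∀ S T : Set V, S ⊆ T → F S ≤ F T := fun S T h =>
    add_le_add (add_le_add (mul_le_mul_of_nonneg_left (ite_or_mono x y h) hγ0)
      (mul_le_mul_of_nonneg_left (ite_and_mono y z h) hα0)) (mul_le_mul_of_nonneg_left (ite_or_mono x z h) hβ0)
  have hF0 : ∀ S, 0 ≤ F S := fun S =>
    add_nonneg (add_nonneg (mul_nonneg hγ0 (ite_nonneg' _)) (mul_nonneg hα0 (ite_nonneg' _))) (mul_nonneg hβ0 (ite_nonneg' _))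
  obtain ⟨hDx, hDy, hK, hG⟩ := eval_F2 w x y z N α β γ F hF Ox Oy Ex Ey Ez E2 E3 B3 hOx hOy hEx hEy hEz hE2 hE3 hB3
  have hbal1 : γ * μ.real E3 - α * μ.real B3 = 0 := by rw [hα, hγ]; ring
  have hbal2 : γ * μ.real E3 - β * μ.real E2 = 0 := by rw [hβ, hγ]; ring
  have hDx0 : ∫ ω, F (openCluster ω z) ∂μ ≤ ∫ ω, F (openCluster ω x) ∂μ := by linarith
  have hDy0 : ∫ ω, F (openCluster ω z) ∂μ ≤ ∫ ω, F (openCluster ω y) ∂μ := by linarith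
  have key := Q7Psi.gpsi_three_glued w x y z N hxy hxz hyz F hFm hDx0 hDy0
  rw [hα, hβ, hγ] at hG
  linarith

end HexagonRows

end

end Summit.CriticalPhenomena.PercolationContinuityZ3.Theorems
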